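import Summits.CriticalPhenomena.CardyFormulaZ2.Theorems.CardyFlipRussoVoronoiHubFromSmirnovStubMeckeRussoPerturbation
import Mathlib.MeasureTheory.Integral.IntervalIntegral.FundThmCalculus

/-!
# Stub `stub_meckeRusso` (S1) of line `moebius-exact-delaunay-dilation-ward` — two colours:
# expansion of pair probabilities, and the calculus lemma
# (crux `VoronoiHubFromSmirnov`, stmt-CriticalPhenomena-6433)

* `expansion_pair` (registered `s1_expansionPair`): for `P` Poisson(`κ`) and `Q` Poisson(`κ + β`)
  (`κ` σ-finite, `β` finite atomless, `b = β(ℂ)`) and a measurable event `S` of PAIRS of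
  configurations, the law of two independent copies expands to first order with the two-colour
  insertion response:
  `|(Q⊗Q)(S) - (P⊗P)(S) - ∫ [(P⊗P){(c₁ ∪ {z}, c₂) ∈ S} + (P⊗P){(c₁, c₂ ∪ {z}) ∈ S} - 2 (P⊗P)(S)] β(dz)| ≤ 8 b²`,
  `|(Q⊗Q)(S) - (P⊗P)(S)| ≤ 2 b`, and the insertion responses of `Q⊗Q` and `P⊗P` differ by at most
  `8 b` pointwise — from the one-process expansion `expansion_one` applied in each coordinate
  (Fubini: the other coordinate integrates out to a `[0,1]`-valued measurable functional).
* `integral_eq_sub_of_sq_increments`: the elementary calculus step of the Margulis–Russo formula —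
  if `|f(t') - f(t) - (t'-t) g(t)| ≤ K (t'-t)²`, `|g(t') - g(t)| ≤ K (t'-t)` and `|g| ≤ K` for
  `0 ≤ t ≤ t' ≤ 1`, then `f(1) - f(0) = ∫₀¹ g` (FTC for right derivatives,
  `intervalIntegral.integral_eq_sub_of_hasDeriv_right_of_le`).
-/

noncomputable section

namespace Summit.CriticalPhenomena.CardyFormulaZ2.Cruxes.VoronoiHubFromSmirnov.MoebiusExactDelaunayDilationWard

open scoped Topology ENNReal Interval
open Filter Set MeasureTheory
open Literature.Analysis.FunctionSpaces
open Literature.Probability.RandomPlanarGeometry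

/-! ### Product probabilities as integrals of section probabilities -/

section Sections

variable {X Y : Measure (PointConfig ℂ)}

/-- `(X ⊗ Y)(S) = ∫ Y(S_c) X(dc)` in real form (finite `Y`). [folklore] -/
theorem measureReal_prod_apply [SFinite X] [IsFiniteMeasure Y]
    {S : Set (PointConfig ℂ × PointConfig ℂ)} (hS : MeasurableSet S) :
    (X.prod Y).real S = ∫ c, Y.real (Prod.mk c ⁻¹' S) ∂X := by
  rw [measureReal_def, Measure.prod_apply hS, ← integral_toReal
    (measurable_measure_prodMk_left hS).aemeasurable (Eventually.of_forall fun c => measure_lt_top Y _)]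
  rfl

/-- `(X ⊗ Y)(S) = ∫ X(S^d) Y(dd)` in real form (finite `X`, s-finite `Y`). [folklore] -/
theorem measureReal_prod_apply_symm [IsFiniteMeasure X] [SFinite Y]
    {S : Set (PointConfig ℂ × PointConfig ℂ)} (hS : MeasurableSet S) :
    (X.prod Y).real S = ∫ d, X.real ((fun c => (c, d)) ⁻¹' S) ∂Y := by
  rw [measureReal_def, Measure.prod_apply_symm hS, ← integral_toReal
    (measurable_measure_prodMk_right hS).aemeasurable (Eventually.of_forall fun d => measure_lt_top X _)]
  rfl

/-- Section probabilities are measurable and `[0,1]`-valued (left sections). [folklore] -/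
theorem measurable_measureReal_section_left [IsProbabilityMeasure Y]
    {S : Set (PointConfig ℂ × PointConfig ℂ)} (hS : MeasurableSet S) :
    Measurable (fun c => Y.real (Prod.mk c ⁻¹' S)) ∧ ∀ c, Y.real (Prod.mk c ⁻¹' S) ∈ Icc (0:ℝ) 1 :=
  ⟨ENNReal.measurable_toReal.comp (measurable_measure_prodMk_left hS),
    fun _ => ⟨measureReal_nonneg, measureReal_le_one⟩⟩

/-- Section probabilities are measurable and `[0,1]`-valued (right sections). [folklore] -/
theorem measurable_measureReal_section_right [IsProbabilityMeasure X]
    {S : Set (PointConfig ℂ × PointConfig ℂ)} (hS : MeasurableSet S) :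
    Measurable (fun d => X.real ((fun c => (c, d)) ⁻¹' S)) ∧
      ∀ d, X.real ((fun c => (c, d)) ⁻¹' S) ∈ Icc (0:ℝ) 1 :=
  ⟨ENNReal.measurable_toReal.comp (measurable_measure_prodMk_right hS),
    fun _ => ⟨measureReal_nonneg, measureReal_le_one⟩⟩

end Sections

/-! ### Two colours: expansion of pair probabilities -/

section Pairs

variable {κ β : Measure ℂ} [SigmaFinite κ] {P Q : Measure (PointConfig ℂ)}

/-- Zeroth order in the second coordinate: `|(P⊗Q)(T) - (P⊗P)(T)| ≤ b`. [cite: LastPenrose2017, Thm 19.1] -/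
theorem pair_zeroth_right (hβfin : β univ ≠ ∞) (hβ0 : ∀ x, β {x} = 0)
    (hP : IsPoissonPointProcess κ P) (hQ : IsPoissonPointProcess (κ + β) Q)
    {T : Set (PointConfig ℂ × PointConfig ℂ)} (hT : MeasurableSet T) :
    |(P.prod Q).real T - (P.prod P).real T| ≤ β.real univ := by
  haveI := hP.isProbabilityMeasure
  haveI := hQ.isProbabilityMeasure
  obtain ⟨hGm, hG⟩ := measurable_measureReal_section_right (X := P) hT
  rw [measureReal_prod_apply_symm hT, measureReal_prod_apply_symm hT]
  exact (expansion_one hβfin hβ0 hP hQ hGm hG).2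

/-- Zeroth order in the first coordinate: `|(Q⊗Q)(T) - (P⊗Q)(T)| ≤ b`. [cite: LastPenrose2017, Thm 19.1] -/
theorem pair_zeroth_left (hβfin : β univ ≠ ∞) (hβ0 : ∀ x, β {x} = 0)
    (hP : IsPoissonPointProcess κ P) (hQ : IsPoissonPointProcess (κ + β) Q)
    {T : Set (PointConfig ℂ × PointConfig ℂ)} (hT : MeasurableSet T) :
    |(Q.prod Q).real T - (P.prod Q).real T| ≤ β.real univ := by
  haveI := hP.isProbabilityMeasure
  haveI := hQ.isProbabilityMeasure
  obtain ⟨hFm, hF⟩ := measurable_measureReal_section_left (Y := Q) hT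
  rw [measureReal_prod_apply hT, measureReal_prod_apply hT]
  exact (expansion_one hβfin hβ0 hP hQ hFm hF).2

/-- **Zeroth order for pairs**: `|(Q⊗Q)(T) - (P⊗P)(T)| ≤ 2 b`. [cite: LastPenrose2017, Thm 19.1] -/
theorem pair_zeroth (hβfin : β univ ≠ ∞) (hβ0 : ∀ x, β {x} = 0)
    (hP : IsPoissonPointProcess κ P) (hQ : IsPoissonPointProcess (κ + β) Q)
    {T : Set (PointConfig ℂ × PointConfig ℂ)} (hT : MeasurableSet T) :
    |(Q.prod Q).real T - (P.prod P).real T| ≤ 2 * β.real univ := by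
  have h1 := pair_zeroth_left hβfin hβ0 hP hQ hT
  have h2 := pair_zeroth_right hβfin hβ0 hP hQ hT
  calc |(Q.prod Q).real T - (P.prod P).real T|
      = |((Q.prod Q).real T - (P.prod Q).real T) + ((P.prod Q).real T - (P.prod P).real T)| := by
        ring_nf
    _ ≤ |(Q.prod Q).real T - (P.prod Q).real T| + |(P.prod Q).real T - (P.prod P).real T| :=
        abs_add_le _ _
    _ ≤ 2 * β.real univ := by linarith

/-- **The insertion responses of `Q⊗Q` and `P⊗P` differ by at most `8 b`** pointwise.
[cite: LastPenrose2017, Thm 19.1] -/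
theorem pair_insResp_diff (hβfin : β univ ≠ ∞) (hβ0 : ∀ x, β {x} = 0)
    (hP : IsPoissonPointProcess κ P) (hQ : IsPoissonPointProcess (κ + β) Q)
    {S : Set (PointConfig ℂ × PointConfig ℂ)} (hS : MeasurableSet S) (z : ℂ) :
    |((Q.prod Q).real {c | (insertAt z c.1, c.2) ∈ S} + (Q.prod Q).real {c | (c.1, insertAt z c.2) ∈ S}
        - 2 * (Q.prod Q).real S)
      - ((P.prod P).real {c | (insertAt z c.1, c.2) ∈ S} + (P.prod P).real {c | (c.1, insertAt z c.2) ∈ S}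
        - 2 * (P.prod P).real S)| ≤ 8 * β.real univ := by
  have h1 := pair_zeroth hβfin hβ0 hP hQ (measurableSet_insertFst hS z)
  have h2 := pair_zeroth hβfin hβ0 hP hQ (measurableSet_insertSnd hS z)
  have h3 := pair_zeroth hβfin hβ0 hP hQ hS
  rw [abs_le] at h1 h2 h3 ⊢
  constructor <;> linarith [h1.1, h1.2, h2.1, h2.2, h3.1, h3.2]

/-- **First-order expansion of pair probabilities** (two independent Poisson processes of the same
intensity, perturbed simultaneously; Last–Penrose 2017 Thm 19.1 applied in each coordinate):
`|(Q⊗Q)(S) - (P⊗P)(S) - ∫ [(P⊗P){ins₁(z) ∈ S} + (P⊗P){ins₂(z) ∈ S} - 2(P⊗P)(S)] β(dz)| ≤ 8 b²`.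
[cite: LastPenrose2017, Thm 19.1] -/
theorem s1_expansionPair : ∀ (κ β : Measure ℂ) [SigmaFinite κ], β univ ≠ ∞ → (∀ x, β {x} = 0) → ∀ (P Q : Measure (PointConfig ℂ)), IsPoissonPointProcess κ P → IsPoissonPointProcess (κ + β) Q → ∀ (S : Set (PointConfig ℂ × PointConfig ℂ)), MeasurableSet S → |(Q.prod Q).real S - (P.prod P).real S - ∫ z, ((P.prod P).real {c | (insertAt z c.1, c.2) ∈ S} + (P.prod P).real {c | (c.1, insertAt z c.2) ∈ S} - 2 * (P.prod P).real S) ∂β| ≤ 8 * β.real univ ^ 2 := by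
  intro κ β _ hβfin hβ0 P Q hP hQ S hS
  haveI : IsFiniteMeasure β := ⟨hβfin.lt_top⟩
  haveI := hP.isProbabilityMeasure
  haveI := hQ.isProbabilityMeasure
  set b := β.real univ with hb_def
  have hb : 0 ≤ b := measureReal_nonneg
  -- first coordinate: `F₁ c = Q{d | (c, d) ∈ S}`
  obtain ⟨hFm, hF⟩ := measurable_measureReal_section_left (Y := Q) hS
  have A := (expansion_one hβfin hβ0 hP hQ hFm hF).1
  -- second coordinate: `G d = P{c | (c, d) ∈ S}`
  obtain ⟨hGm, hG⟩ := measurable_measureReal_section_right (X := P) hS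
  have B := (expansion_one hβfin hβ0 hP hQ hGm hG).1
  -- identification of the terms
  have iQQ : (Q.prod Q).real S = ∫ c, Q.real (Prod.mk c ⁻¹' S) ∂Q := measureReal_prod_apply hS
  have iPQ : (P.prod Q).real S = ∫ c, Q.real (Prod.mk c ⁻¹' S) ∂P := measureReal_prod_apply hS
  have iPQ' : (P.prod Q).real S = ∫ d, P.real ((fun c => (c, d)) ⁻¹' S) ∂Q :=
    measureReal_prod_apply_symm hS
  have iPP : (P.prod P).real S = ∫ d, P.real ((fun c => (c, d)) ⁻¹' S) ∂P :=
    measureReal_prod_apply_symm hS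
  have iPQz : ∀ z, (P.prod Q).real {c | (insertAt z c.1, c.2) ∈ S}
      = ∫ c, Q.real (Prod.mk (insertAt z c) ⁻¹' S) ∂P := fun z =>
    measureReal_prod_apply (measurableSet_insertFst hS z)
  have iPPz : ∀ z, (P.prod P).real {c | (c.1, insertAt z c.2) ∈ S}
      = ∫ d, P.real ((fun c => (c, insertAt z d)) ⁻¹' S) ∂P := fun z =>
    measureReal_prod_apply_symm (measurableSet_insertSnd hS z)
  -- the replacement `P⊗Q → P⊗P` in the first-coordinate insertion term
  set D : ℂ → ℝ := fun z => ((P.prod Q).real {c | (insertAt z c.1, c.2) ∈ S} - (P.prod Q).real S)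
    - ((P.prod P).real {c | (insertAt z c.1, c.2) ∈ S} - (P.prod P).real S) with hD_def
  have hD : ∀ z, |D z| ≤ 2 * b := fun z => by
    have h1 := pair_zeroth_right hβfin hβ0 hP hQ (measurableSet_insertFst hS z)
    have h2 := pair_zeroth_right hβfin hβ0 hP hQ hS
    rw [abs_le] at h1 h2 ⊢
    constructor <;> linarith [h1.1, h1.2, h2.1, h2.2]
  have hDint : |∫ z, D z ∂β| ≤ 2 * b * b := by
    have := norm_integral_le_of_norm_le_const (μ := β) (f := D) (C := 2 * b)
      (Eventually.of_forall fun z => by rw [Real.norm_eq_abs]; exact hD z)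
    rwa [Real.norm_eq_abs] at this
  -- integrability of the three insertion integrands against `β`
  have hI1 : Integrable (fun z => (P.prod Q).real {c | (insertAt z c.1, c.2) ∈ S} - (P.prod Q).real S) β :=
    Integrable.of_bound (((measurable_measureReal_insertFst (P.prod Q) hS).sub measurable_const).aestronglyMeasurable)
      1 (Eventually.of_forall fun z => by
        rw [Real.norm_eq_abs, abs_le]
        have := measureReal_le_one (μ := P.prod Q) (s := {c | (insertAt z c.1, c.2) ∈ S})
        have := measureReal_le_one (μ := P.prod Q) (s := S)
        have := measureReal_nonneg (μ := P.prod Q) (s := {c | (insertAt z c.1, c.2) ∈ S})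
        have := measureReal_nonneg (μ := P.prod Q) (s := S)
        constructor <;> linarith)
  have hI2 : Integrable (fun z => (P.prod P).real {c | (c.1, insertAt z c.2) ∈ S} - (P.prod P).real S) β :=
    Integrable.of_bound (((measurable_measureReal_insertSnd (P.prod P) hS).sub measurable_const).aestronglyMeasurable)
      1 (Eventually.of_forall fun z => by
        rw [Real.norm_eq_abs, abs_le]
        have := measureReal_le_one (μ := P.prod P) (s := {c | (c.1, insertAt z c.2) ∈ S})
        have := measureReal_le_one (μ := P.prod P) (s := S)
        have := measureReal_nonneg (μ := P.prod P) (s := {c | (c.1, insertAt z c.2) ∈ S})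
        have := measureReal_nonneg (μ := P.prod P) (s := S)
        constructor <;> linarith)
  have hI3 : Integrable D β :=
    Integrable.of_bound ((((measurable_measureReal_insertFst (P.prod Q) hS).sub measurable_const).sub
      ((measurable_measureReal_insertFst (P.prod P) hS).sub measurable_const)).aestronglyMeasurable)
      (2 * b) (Eventually.of_forall fun z => by rw [Real.norm_eq_abs]; exact hD z)
  have hI12 : Integrable (fun z => ((P.prod Q).real {c | (insertAt z c.1, c.2) ∈ S} - (P.prod Q).real S)
      + ((P.prod P).real {c | (c.1, insertAt z c.2) ∈ S} - (P.prod P).real S)) β := hI1.add hI2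
  have hsplit : ∫ z, ((P.prod P).real {c | (insertAt z c.1, c.2) ∈ S}
      + (P.prod P).real {c | (c.1, insertAt z c.2) ∈ S} - 2 * (P.prod P).real S) ∂β
      = ∫ z, ((P.prod Q).real {c | (insertAt z c.1, c.2) ∈ S} - (P.prod Q).real S) ∂β
        + ∫ z, ((P.prod P).real {c | (c.1, insertAt z c.2) ∈ S} - (P.prod P).real S) ∂β
        - ∫ z, D z ∂β := by
    have hfun : (fun z => (P.prod P).real {c | (insertAt z c.1, c.2) ∈ S}
        + (P.prod P).real {c | (c.1, insertAt z c.2) ∈ S} - 2 * (P.prod P).real S)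
        = fun z => (((P.prod Q).real {c | (insertAt z c.1, c.2) ∈ S} - (P.prod Q).real S)
          + ((P.prod P).real {c | (c.1, insertAt z c.2) ∈ S} - (P.prod P).real S)) - D z := by
      funext z
      simp only [hD_def]
      ring
    rw [hfun, integral_sub hI12 hI3, integral_add hI1 hI2]
  -- rewrite the two one-coordinate expansions in pair vocabulary
  rw [← iQQ, ← iPQ] at A
  simp_rw [← iPQz] at A
  rw [← iPQ', ← iPP] at B
  simp_rw [← iPPz] at B
  rw [hsplit]
  have key : (Q.prod Q).real S - (P.prod P).real S
      - (∫ z, ((P.prod Q).real {c | (insertAt z c.1, c.2) ∈ S} - (P.prod Q).real S) ∂β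
        + ∫ z, ((P.prod P).real {c | (c.1, insertAt z c.2) ∈ S} - (P.prod P).real S) ∂β
        - ∫ z, D z ∂β)
      = ((Q.prod Q).real S - (P.prod Q).real S
          - ∫ z, ((P.prod Q).real {c | (insertAt z c.1, c.2) ∈ S} - (P.prod Q).real S) ∂β)
        + ((P.prod Q).real S - (P.prod P).real S
          - ∫ z, ((P.prod P).real {c | (c.1, insertAt z c.2) ∈ S} - (P.prod P).real S) ∂β)
        + ∫ z, D z ∂β := by ring
  rw [key]
  calc _ ≤ |(Q.prod Q).real S - (P.prod Q).real S
          - ∫ z, ((P.prod Q).real {c | (insertAt z c.1, c.2) ∈ S} - (P.prod Q).real S) ∂β|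
        + |(P.prod Q).real S - (P.prod P).real S
          - ∫ z, ((P.prod P).real {c | (c.1, insertAt z c.2) ∈ S} - (P.prod P).real S) ∂β|
        + |∫ z, D z ∂β| := abs_add_three _ _ _
    _ ≤ 3 * b ^ 2 + 3 * b ^ 2 + 2 * b * b := by linarith [A, B, hDint]
    _ = 8 * b ^ 2 := by ring

/-- `s1_expansionPair` with implicit arguments, together with the zeroth-order bound and the
pointwise bound on insertion responses. [cite: LastPenrose2017, Thm 19.1] -/
theorem expansion_pair (hβfin : β univ ≠ ∞) (hβ0 : ∀ x, β {x} = 0)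
    (hP : IsPoissonPointProcess κ P) (hQ : IsPoissonPointProcess (κ + β) Q)
    {S : Set (PointConfig ℂ × PointConfig ℂ)} (hS : MeasurableSet S) :
    |(Q.prod Q).real S - (P.prod P).real S - ∫ z, ((P.prod P).real {c | (insertAt z c.1, c.2) ∈ S}
        + (P.prod P).real {c | (c.1, insertAt z c.2) ∈ S} - 2 * (P.prod P).real S) ∂β|
        ≤ 8 * β.real univ ^ 2 ∧
      |(Q.prod Q).real S - (P.prod P).real S| ≤ 2 * β.real univ ∧
      ∀ z, |((Q.prod Q).real {c | (insertAt z c.1, c.2) ∈ S}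
          + (Q.prod Q).real {c | (c.1, insertAt z c.2) ∈ S} - 2 * (Q.prod Q).real S)
        - ((P.prod P).real {c | (insertAt z c.1, c.2) ∈ S}
          + (P.prod P).real {c | (c.1, insertAt z c.2) ∈ S} - 2 * (P.prod P).real S)|
        ≤ 8 * β.real univ :=
  ⟨s1_expansionPair κ β hβfin hβ0 P Q hP hQ S hS, pair_zeroth hβfin hβ0 hP hQ hS,
    pair_insResp_diff hβfin hβ0 hP hQ hS⟩

end Pairs

/-! ### The calculus step: from quadratic increments to the integrated formula -/

/-- **Integrated form from one-sided quadratic increments.** If on `[0,1]`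
`|f(t') - f(t) - (t'-t) g(t)| ≤ K (t'-t)²`, `|g(t') - g(t)| ≤ K (t'-t)` and `|g(t)| ≤ K` for all
`0 ≤ t ≤ t' ≤ 1`, then `f(1) - f(0) = ∫₀¹ g`: `f` is Lipschitz on `[0,1]`, has right derivative
`g(t)` at every interior point, and `g` is Lipschitz hence integrable — FTC for right derivatives
(`intervalIntegral.integral_eq_sub_of_hasDeriv_right_of_le`). [folklore] -/
theorem integral_eq_sub_of_sq_increments {f g : ℝ → ℝ} {K : ℝ}
    (h : ∀ t t', 0 ≤ t → t ≤ t' → t' ≤ 1 →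
      |f t' - f t - (t' - t) * g t| ≤ K * (t' - t) ^ 2 ∧ |g t' - g t| ≤ K * (t' - t) ∧ |g t| ≤ K) :
    f 1 - f 0 = ∫ t in (0:ℝ)..1, g t := by
  have hK : 0 ≤ K := (abs_nonneg _).trans (h 0 0 le_rfl le_rfl zero_le_one).2.2
  -- Lipschitz bounds on `[0,1]`
  have hf : ∀ t t', 0 ≤ t → t ≤ t' → t' ≤ 1 → |f t' - f t| ≤ 2 * K * (t' - t) := by
    intro t t' h0 htt' h1
    obtain ⟨h1', -, h3'⟩ := h t t' h0 htt' h1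
    have hsq : K * (t' - t) ^ 2 ≤ K * (t' - t) := by
      apply mul_le_mul_of_nonneg_left _ hK
      nlinarith
    have hg : |(t' - t) * g t| ≤ (t' - t) * K := by
      rw [abs_mul, abs_of_nonneg (sub_nonneg.2 htt')]
      exact mul_le_mul_of_nonneg_left h3' (sub_nonneg.2 htt')
    calc |f t' - f t| = |(f t' - f t - (t' - t) * g t) + (t' - t) * g t| := by ring_nf
      _ ≤ |f t' - f t - (t' - t) * g t| + |(t' - t) * g t| := abs_add_le _ _
      _ ≤ 2 * K * (t' - t) := by linarith
  have hlip : ∀ (u : ℝ → ℝ) (L : ℝ), 0 ≤ L →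
      (∀ t t', 0 ≤ t → t ≤ t' → t' ≤ 1 → |u t' - u t| ≤ L * (t' - t)) → ContinuousOn u (Icc 0 1) := by
    intro u L hL hu
    rw [Metric.continuousOn_iff]
    intro x hx ε hε
    refine ⟨ε / (L + 1), div_pos hε (by linarith), fun y hy hxy => ?_⟩
    rw [Real.dist_eq] at hxy ⊢
    have hbound : |u y - u x| ≤ L * |y - x| := by
      rcases le_total x y with hle | hle
      · rw [abs_of_nonneg (sub_nonneg.2 hle)]
        exact hu x y hx.1 hle hy.2
      · rw [abs_sub_comm, abs_of_nonpos (sub_nonpos.2 hle), neg_sub]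
        exact hu y x hy.1 hle hx.2
    calc |u y - u x| ≤ L * |y - x| := hbound
      _ ≤ L * (ε / (L + 1)) := mul_le_mul_of_nonneg_left hxy.le hL
      _ < ε := by
        rw [mul_div_assoc']
        rw [div_lt_iff₀ (by linarith)]
        nlinarith
  have hcont : ContinuousOn f (Icc 0 1) := hlip f (2 * K) (by linarith) hf
  have hgcont : ContinuousOn g (Icc 0 1) :=
    hlip g K hK fun t t' h0 htt' h1 => (h t t' h0 htt' h1).2.1
  have hderiv : ∀ x ∈ Ioo (0:ℝ) 1, HasDerivWithinAt f (g x) (Ioi x) x := by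
    intro x hx
    rw [hasDerivWithinAt_iff_isLittleO, Asymptotics.isLittleO_iff]
    intro c hc
    have hxc : x < min 1 (x + c / (K + 1)) :=
      lt_min hx.2 (by linarith [div_pos hc (show (0:ℝ) < K + 1 by linarith)])
    filter_upwards [Ioo_mem_nhdsGT hxc] with y hy
    have hy1 : y < 1 := hy.2.trans_le (min_le_left _ _)
    have hy2 : y - x < c / (K + 1) := by linarith [hy.2.trans_le (min_le_right _ _)]
    have hxy : 0 < y - x := sub_pos.2 hy.1
    obtain ⟨h1', -, -⟩ := h x y hx.1.le hy.1.le hy1.le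
    rw [smul_eq_mul, Real.norm_eq_abs, Real.norm_eq_abs, abs_of_pos hxy]
    calc |f y - f x - (y - x) * g x| ≤ K * (y - x) ^ 2 := h1'
      _ = (K * (y - x)) * (y - x) := by ring
      _ ≤ c * (y - x) := by
        apply mul_le_mul_of_nonneg_right _ hxy.le
        calc K * (y - x) ≤ K * (c / (K + 1)) := mul_le_mul_of_nonneg_left hy2.le hK
          _ ≤ c := by
            rw [mul_div_assoc', div_le_iff₀ (by linarith)]
            nlinarith
  have hint : IntervalIntegrable g volume 0 1 := by
    refine ContinuousOn.intervalIntegrable ?_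
    rw [uIcc_of_le zero_le_one]
    exact hgcont
  exact (intervalIntegral.integral_eq_sub_of_hasDeriv_right_of_le zero_le_one hcont hderiv hint).symm

end Summit.CriticalPhenomena.CardyFormulaZ2.Cruxes.VoronoiHubFromSmirnov.MoebiusExactDelaunayDilationWard

end
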